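import Mathlib
import HarnessLib

/-!
# Yu's `p`-adic logarithmic forms in Stewart's form (Stewart 2013, Lemma 5 / Lemma 3.1), over `ℚ`

Topic `NumberTheory/DiophantineGeometry`; namespace `Literature.NumberTheory.DiophantineGeometry.Dioph`.

C. L. Stewart, *On divisors of Lucas and Lehmer numbers*, Acta Math. 211 (2013), 291–314
[Stewart2013] (Lemma 3.1, pp. 301–302 of the journal = Lemma 5, p. 8 of arXiv:1008.1274, held as
`paper:arxiv-1008.1274`; the two printings are word-for-word identical), derives from the Main
Theorem of K. Yu, *p-adic logarithmic forms and a problem of Erdős*, Acta Math. 211 (2013),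
315–382 [Yu2013] the following estimate. Let `α₁, …, αₙ` be non-zero algebraic numbers,
`K = ℚ(α₁, …, αₙ)`, `d = [K : ℚ]`, `℘` a prime ideal of `𝒪_K` above `p` with residue degree `f_℘`,
`α₀ = ζ_{2^u}` where `ζ_{2^u} ∈ K`, `ζ_{2^{u+1}} ∉ K`; for multiplicatively independent `℘`-adic
units `α₁, …, αₙ` put `δ = 1` if `[K(α₀^{1/2}, …, αₙ^{1/2}) : K] < 2^{n+1}` and
`δ = (p^{f_℘} - 1)/|⟨ᾱ₀, ᾱ₁, …, ᾱₙ⟩|` (the subgroup of the unit group of the residue field at `℘`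
generated by the reductions) if `[K(α₀^{1/2}, …, αₙ^{1/2}) : K] = 2^{n+1}` ((16) = (3.1)).

> **Lemma 5 (= Lemma 3.1), as printed.** Let `p ≥ 5` be prime and `℘` an unramified prime ideal
> of `𝒪_K` above `p`. Let `α₁, …, αₙ` be multiplicatively independent `℘`-adic units, `b₁, …, bₙ`
> integers, not all zero, `B = max(2, |b₁|, …, |bₙ|)`. Then
> `ord_℘(α₁^{b₁}⋯αₙ^{bₙ} - 1) < C h(α₁)⋯h(αₙ) max(log B, (n+1)(5.4n + log d))` with
> `C = 376 (n+1)^{1/2} (7e (p-1)/(p-2))ⁿ d^{n+2} log*d · log(e⁴(n+1)d) ·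
>      max(p^{f_℘} δ⁻¹ (n/(f_℘ log p))ⁿ, eⁿ f_℘ log p)`,
> `h` the absolute logarithmic Weil height, `log* x = log max(x, e)`.

> **Its printed proof** (ibid.): Yu's Main Theorem [Yu2013, (1.18)] with `C₁(n,d,℘,a) h⁽¹⁾` in
> place of the minimum, the constants `c⁽¹⁾ = 1794`, `a⁽¹⁾ = 7(p−1)/(p−2)`, `a₀⁽¹⁾ = 2 + log 7`,
> `a₁⁽¹⁾ = a₂⁽¹⁾ = 5.25`, and Voutier's explicit Dobrowolski bound for the first term of `h⁽¹⁾`,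
> give ("Therefore we find that")
> `ord_℘(⋯) < C₁ h(α₁)⋯h(αₙ) max(log B, G₁, (n+1) f_℘ log p)`,                               (P)
> `G₁ = (n+1)((2 + log 7)n + 5.25 + log((2 + log 7)n + 5.25) + log d)`,
> `C₁ = 1794 (7(p−1)/(p−2))ⁿ ((n+1)^{n+1}/n!) d^{n+2} log*d/(2^u (f_℘ log p)²) max(⋯) max(log(e⁴(n+1)d), f_℘ log p)`;
> then `2^u ≥ 2`, `f_℘ log p ≥ log 5` and Stirling give
> `ord_℘(⋯) < C₂ h(α₁)⋯h(αₙ) max(log B/log 5, G₁/log 5, n+1)` ((17) = (3.2)) with `C₂/log 5 ≤ C`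
> ((18) = (3.3)), and finally "`G₁ ≤ (n+1)(5.4n + log d)`" ((19) = (3.4)).

## What this file vendors: the case `K = ℚ`, in the form the literature establishes

For `K = ℚ`: `d = 1`, `℘ = p` (always unramified), `f_℘ = 1`, `log* d = 1`, `α₀ = ζ₂ = −1`
(`i ∉ ℚ`, so `u = 1`, `2^u = 2` exactly), `ord_℘ = padicValRat p`, `h = Height.logHeight₁`
(`= log max(|num|, den)` on `ℚ`, `Rat.logHeight₁_eq_log_max`), `δ = stewartDelta p α` exactly as
printed (Kummer condition (16) realised in `ℂ`; the subgroup of `𝔽_pˣ` generated by `−1` and the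
reductions `ᾱᵢ`). The named fact `Stewart2013_lemma5_rat` is

  `ord_p(α₁^{b₁}⋯αₙ^{bₙ} − 1) < C · h(α₁)⋯h(αₙ) · max(log B, G₁^ℚ(n))`,   `C = stewartC n p δ`,
  `G₁^ℚ(n) = yuG1Rat n = (n+1)((2 + log 7)n + 5.84 + log((2 + log 7)n + 5.84))`,

i.e. the printed intermediate bound (17)–(18) = (3.2)–(3.3) of Stewart's proof (with Stewart's
constant `C`), in which `G₁` is taken with the constants that Yu's *published* Main Theorem
prescribes for `d = 1`: [Yu2013, §1.3, (1.28), (1.30), (1.31), case (III.2): `p ≥ 5`, `e_℘ = 1`,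
`d = 1`] give `c⁽¹⁾ = 1790`, `a⁽¹⁾ = 7(p−1)/(p−2)`, `a₀⁽¹⁾ = 2 + log 7`, `a₁⁽¹⁾ = a₂⁽¹⁾ = 5.84`, and
[Yu2013, (1.11)] `G₁(n,d) = (n+1)(a₀⁽¹⁾ n + a₁⁽¹⁾ + log(a₀⁽¹⁾ n + a₂⁽¹⁾) + log d)`. This statement
follows from Yu's Main Theorem [Yu2013, p. 321, (1.16)–(1.18), with (1.6)–(1.9), (1.11),
(1.13)–(1.15)] for `n ≥ 2` by Stewart's own steps (17)–(18), all of which are PROVED in the sibling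
file `StewartYuPadicLogFormsReduction.lean` (`Stewart2013_lemma5_rat_G1_of_printedYuBound`: its
proof uses of `G₁` only `G₁ ≥ 15(n+1)`, and `1790 ≤ 1794`, `δ_Stewart ≤ δ(a)` by (1.8) and
`δ(a) ≥ 1`, `B_Yu = min_{bⱼ≠0}|bⱼ| ≤ B`, and over `ℚ` the first term of `h⁽¹⁾` is `≤ log B` because
`ω(1) = log 2 · log 3/log 6` (1.15) and two multiplicatively independent rationals have heights
`≥ log 2` and `≥ log 3`); for `n ≤ 1` it is elementary and PROVED (`StewartYuPadicLogFormsProofs`,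
`Stewart2013_lemma5_rat_of_le_one`, in the printed form, which implies this one since
`(n+1) · 5.4n ≤ G₁^ℚ(n)` for `n ≤ 6`). Nothing of Baker's theory is proved in the tree: for `n ≥ 2`
the fact IS Yu's Theorem I over `ℚ` (p-adic logarithmic forms), an XL apex of the literature.

Since `δ ≥ 1` (`one_le_stewartDelta`) and `C` is non-increasing in `δ` (`stewartC_anti`), the bound
with `δ` replaced by `1` follows (`Stewart2013_lemma5_rat.delta_one`, proved) — the shape used in
Stewart's Lemma 8 ((29)) and by route `ABC/LogCardinality` (item `SubPowerStewartYu`, which inlines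
its own weakened copy and does not import this fact).

## Restatement record (review-split seat, 2026-08-15): why not the printed `max(log B, (n+1)·5.4n)`

Until 2026-08-15 this fact was vendored verbatim in the printed form
`max(log B, (n+1)(5.4n + log d))` (`d = 1`), with a caveat. Reading both published papers on the
page shows that the printed form is, over `ℚ`, slightly STRONGER than what the literature proves:

* Step (19) = (3.4), "`G₁ ≤ (n+1)(5.4n + log d)`", is false for `d = 1` and small `n`: with
  Stewart's `5.25` it holds iff `n ≥ 6` (machine-checked: `stewart_G1_le` / `stewart_G1_gt` in
  `StewartYuPadicLogFormsProofs.lean`; `G₁/(n+1) ≈ 11.41, 15.72, 19.93, 24.08, 28.20` against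
  `5.4n` for `n = 1, …, 5`), and with Yu's published `a₁⁽¹⁾ = a₂⁽¹⁾ = 5.84` (case (III.2), `d = 1`)
  iff `n ≥ 7` (`G₁^ℚ(6)/7 ≈ 32.90 > 32.4`, `G₁^ℚ(7)/8 ≈ 36.97 ≤ 37.8`).
* Stewart's `c⁽¹⁾ = 1794`, `a₁⁽¹⁾ = a₂⁽¹⁾ = 5.25` are not the constants of [Yu2013, (1.30)–(1.31)]
  (`(1794, 4.71, 5.40)` for `d > 1`, `(1790, 5.84, 5.84)` for `d = 1`; the arXiv version cites the
  then unpublished preprint "K. Yu, New advances in p-adic theory of logarithmic forms"). For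
  `d > 1` Stewart's `G₁` dominates Yu's (`5.25 − 4.71 > log(1 + 0.15/13.14)`), for `d = 1` it does
  not.
* Quantitatively (over `ℚ`): the factor `(log p/log 5)²` that (17)–(18) give away restores the
  printed form for every `p ≥ 11`; the printed statement is NOT established only for
  `p = 5, 2 ≤ n ≤ 6` and `p = 7, n = 2`, and there only in the window `≈5·10⁸ < B < e^{G₁}` (the
  Liouville estimate, `Stewart2013_lemma5_rat_of_stewartB_le`, covers `B ≤ 10⁸`). In that corner
  the printed bound is very probably true but has no proof in print; a named fact must not assert
  it (D-0014). The `i = 2` half of Yu's Main Theorem (`C₂ h⁽²⁾`, Theorem II) is not used: its proof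
  is "skipped" in [Yu2013, §1.4].

Hence the restatement to the `(3.2)–(3.3)` form above, which is exactly as strong as the published
argument and implies the printed form for `n ≥ 7` (and, by the elementary proofs, the printed form
holds for `n ≤ 1` and for `B ≤ 10⁸`). No corrected variant of the general-`K` lemma is asserted.

## References

* [Stewart2013] C. L. Stewart, *On divisors of Lucas and Lehmer numbers*, Acta Math. 211 (2013),
  291–314 (arXiv:1008.1274): Lemma 3.1, pp. 301–302, displays (3.1)–(3.4) (= arXiv §3, Lemma 5,
  p. 8, (16)–(19)); Lemma 8, (29).
* [Yu2013] K. Yu, *p-adic logarithmic forms and a problem of Erdős*, Acta Math. 211 (2013),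
  315–382: §1.1 (1.3)–(1.9), (1.11), (1.13)–(1.15), Main Theorem p. 321 (1.16)–(1.18) (stated for
  `n ≥ 2`); §1.3 p. 324 (1.28)–(1.31) (numerical values, case (III.2)); §1.4 (Theorems I, II).
* C. L. Stewart, *On prime factors of terms of linear recurrence sequences*, in: Number Theory and
  Related Fields (J. M. Borwein et al., eds.), Springer PROMS 43 (2013), 341 ff., Lemma 2 (p. 348:
  the printed statement once more, "This is Lemma 3.1 of [42] and it follows from the work of Yu").
-/

open Height Real Finset

noncomputable section

namespace Literature.NumberTheory.DiophantineGeometry.Dioph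

/-! ### The data of Lemma 5 over `ℚ` -/

/-- `B = max(2, |b₁|, …, |bₙ|)` of Stewart's Lemma 5. [cite: Stewart2013, Lemma 5] -/
def stewartB {n : ℕ} (b : Fin n → ℤ) : ℕ :=
  max 2 (univ.sup fun i => (b i).natAbs)

/-- `2 ≤ B`. [cite: Stewart2013, Lemma 5] -/
theorem two_le_stewartB {n : ℕ} (b : Fin n → ℤ) : 2 ≤ stewartB b :=
  le_max_left _ _

/-- `|bᵢ| ≤ B`. [cite: Stewart2013, Lemma 5] -/
theorem natAbs_le_stewartB {n : ℕ} (b : Fin n → ℤ) (i : Fin n) : (b i).natAbs ≤ stewartB b :=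
  le_trans (Finset.le_sup (f := fun i => (b i).natAbs) (mem_univ i)) (le_max_right _ _)

/-- Stewart's constant `C` of Lemma 5 for `d = 1`, `f_℘ = 1` (so `d^{n+2} log* d = 1`), as a
function of `n`, `p` and the parameter `δ`:
`C = 376 (n+1)^{1/2} (7e (p-1)/(p-2))ⁿ log(e⁴(n+1)) max(p δ⁻¹ (n / log p)ⁿ, eⁿ log p)`.
[cite: Stewart2013, Lemma 5] -/
def stewartC (n p : ℕ) (δ : ℝ) : ℝ :=
  376 * Real.sqrt (n + 1) * (7 * Real.exp 1 * (((p : ℝ) - 1) / ((p : ℝ) - 2))) ^ n *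
    Real.log (Real.exp 4 * (n + 1)) *
    max ((p : ℝ) / δ * ((n : ℝ) / Real.log p) ^ n) (Real.exp n * Real.log p)

/-- Unfolding lemma for `stewartC`. [cite: Stewart2013, Lemma 5] -/
theorem stewartC_def (n p : ℕ) (δ : ℝ) : stewartC n p δ =
    376 * Real.sqrt (n + 1) * (7 * Real.exp 1 * (((p : ℝ) - 1) / ((p : ℝ) - 2))) ^ n *
      Real.log (Real.exp 4 * (n + 1)) *
      max ((p : ℝ) / δ * ((n : ℝ) / Real.log p) ^ n) (Real.exp n * Real.log p) :=
  rfl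

/-- **Yu's `G₁(n, 1)` with the published constants for `K = ℚ`**:
`G₁^ℚ(n) = (n+1)((2 + log 7) n + 5.84 + log((2 + log 7) n + 5.84))`, i.e. [Yu2013, (1.11)]
`G₁(n,d) = (n+1)(a₀⁽¹⁾ n + a₁⁽¹⁾ + log(a₀⁽¹⁾ n + a₂⁽¹⁾) + log d)` at `d = 1` with
`a₀⁽¹⁾ = 2 + log 7` ((1.28), case (III)) and `a₁⁽¹⁾ = a₂⁽¹⁾ = 5.84` ((1.30)–(1.31), case (III.2):
`p ≥ 5`, `e_℘ = 1`, `d = 1`). Stewart prints the same expression with `5.25` in place of `5.84`.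
[cite: Yu2013, (1.11), (1.28), (1.30), (1.31)] -/
def yuG1Rat (n : ℕ) : ℝ :=
  ((n : ℝ) + 1) * ((2 + Real.log 7) * n + 5.84 + Real.log ((2 + Real.log 7) * n + 5.84))

/-- Unfolding lemma for `yuG1Rat`. [cite: Yu2013, (1.11)] -/
theorem yuG1Rat_def (n : ℕ) : yuG1Rat n =
    ((n : ℝ) + 1) * ((2 + Real.log 7) * n + 5.84 + Real.log ((2 + Real.log 7) * n + 5.84)) :=
  rfl

/-- `G₁^ℚ(n) ≥ 5.84 > 0` (`log 7 ≥ 0` and the inner logarithm is of a number `≥ 1`).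
[cite: Yu2013, (1.11)] -/
theorem yuG1Rat_pos (n : ℕ) : 0 < yuG1Rat n := by
  rw [yuG1Rat_def]
  have hn : (0 : ℝ) ≤ n := Nat.cast_nonneg n
  have h7 : (0 : ℝ) ≤ Real.log 7 := Real.log_nonneg (by norm_num)
  have hx : (5.84 : ℝ) ≤ (2 + Real.log 7) * n + 5.84 := by nlinarith
  have hlog : (0 : ℝ) ≤ Real.log ((2 + Real.log 7) * n + 5.84) := Real.log_nonneg (by linarith)
  have h1 : (0 : ℝ) < (2 + Real.log 7) * n + 5.84 + Real.log ((2 + Real.log 7) * n + 5.84) := by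
    linarith
  positivity

/-- **Kummer condition (16) of Stewart 2013 for `K = ℚ`**: `[ℚ(α₀^{1/2}, α₁^{1/2}, …, αₙ^{1/2}) : ℚ]
= 2^{n+1}` with `α₀ = ζ₂ = -1` (`u = 1` since `ζ₂ = -1 ∈ ℚ`, `ζ₄ = i ∉ ℚ`), realised inside `ℂ`
with `(-1)^{1/2} = i` and principal square roots (the generated field does not depend on the choice
of square roots). By Kummer theory this says that `-1, α₁, …, αₙ` are multiplicatively independent
modulo squares of `ℚ*`. [cite: Stewart2013, (16)] -/
def StewartKummerCondition {n : ℕ} (α : Fin n → ℚ) : Prop :=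
  Module.finrank ℚ
      ↥(IntermediateField.adjoin ℚ
        (insert Complex.I (Set.range fun i : Fin n => ((α i : ℚ) : ℂ) ^ (1 / 2 : ℂ)))) =
    2 ^ (n + 1)

/-- Reduction modulo `p` of a rational number `q = a/b` (lowest terms): `ā · b̄⁻¹ ∈ ℤ/pℤ`, with
Mathlib's total inverse on `ZMod p` (the genuine residue class of the `p`-adic unit `q` when
`p ∤ ab`; a junk value otherwise). [folklore] -/
def ratModP (p : ℕ) (q : ℚ) : ZMod p :=
  (q.num : ZMod p) * ((q.den : ZMod p))⁻¹

/-- `|⟨ᾱ₀, ᾱ₁, …, ᾱₙ⟩|`, the order of the subgroup of `𝔽_pˣ` generated by `ᾱ₀ = -1` and the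
reductions `ᾱᵢ` of the `p`-adic units `αᵢ` — written as the submonoid of `ℤ/pℤ` they generate
(for units of a finite monoid the generated submonoid is the generated subgroup).
[cite: Stewart2013, §3 (definition of δ)] -/
def stewartSubgroupCard (p : ℕ) {n : ℕ} (α : Fin n → ℚ) : ℕ :=
  Nat.card ↥(Submonoid.closure (insert (-1 : ZMod p) (Set.range fun i : Fin n => ratModP p (α i))))

open Classical in
/-- Stewart's `δ` for `K = ℚ` (`f_℘ = 1`): `δ = (p - 1)/|⟨ᾱ₀, ᾱ₁, …, ᾱₙ⟩|` if the Kummer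
condition (16) holds and `δ = 1` otherwise. [cite: Stewart2013, §3 (definition of δ)] -/
def stewartDelta (p : ℕ) {n : ℕ} (α : Fin n → ℚ) : ℝ :=
  if StewartKummerCondition α then ((p : ℝ) - 1) / (stewartSubgroupCard p α : ℝ) else 1

/-! ### The named fact -/

/-- **Stewart 2013, Lemma 5 = Lemma 3.1 (from Yu 2013, Main Theorem), case `K = ℚ`, in the form
(3.2)–(3.3) that the published proof establishes.** Let `p ≥ 5` be prime, `α₁, …, αₙ ∈ ℚ`
multiplicatively independent `p`-adic units (`ord_p αᵢ = 0`; `∏ αᵢ^{eᵢ} = 1 ⇒ e = 0`), `b ∈ ℤⁿ`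
not all zero, `B = max(2, |bᵢ|)`. Then
`ord_p(α₁^{b₁}⋯αₙ^{bₙ} - 1) < C · h(α₁)⋯h(αₙ) · max(log B, G₁^ℚ(n))` with
`C = stewartC n p δ` (Stewart's printed constant `376⋯` at `d = 1`, `f_℘ = 1`),
`δ = stewartDelta p α`, `h = logHeight₁`, `ord_p = padicValRat p`, and
`G₁^ℚ(n) = yuG1Rat n = (n+1)((2 + log 7)n + 5.84 + log((2 + log 7)n + 5.84))` — Stewart's `G₁`
at `d = 1` with Yu's published `a₁⁽¹⁾ = a₂⁽¹⁾ = 5.84` [Yu2013, (1.30)–(1.31), case (III.2)] in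
place of Stewart's `5.25`. The PRINTED conclusion has `max(log B, (n+1)(5.4n + log d))`; its last
step "`G₁ ≤ (n+1)(5.4n + log d)`" ((19) = (3.4)) fails for `d = 1`, `n ≤ 6`, so the printed form is
vendored only through this one, which implies it for `n ≥ 7` (see the module docstring,
*Restatement record*; the printed form is moreover PROVED for `n ≤ 1` and for `B ≤ 10⁸` in
`StewartYuPadicLogFormsProofs.lean`). For `n ≥ 2` this is Yu's Theorem I over `ℚ` followed by
Stewart's (17)–(18) (the latter proved in `StewartYuPadicLogFormsReduction.lean`); Yu's theorem
itself is not formalised. [cite: Stewart2013, Lemma 3.1 with proof, (3.2)–(3.3)]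
[cite: Yu2013, Main Theorem (1.18) with (1.9), (1.11), (1.13), §1.3 case (III.2)] -/
def Stewart2013_lemma5_rat : Prop :=
  ∀ (n p : ℕ) (α : Fin n → ℚ) (b : Fin n → ℤ), p.Prime → 5 ≤ p →
    (∀ i, α i ≠ 0 ∧ padicValRat p (α i) = 0) →
    (∀ e : Fin n → ℤ, ∏ i, α i ^ e i = 1 → e = 0) →
    b ≠ 0 →
    (padicValRat p (∏ i, α i ^ b i - 1) : ℝ) <
      stewartC n p (stewartDelta p α) * (∏ i, logHeight₁ (α i)) *
        max (Real.log (stewartB b)) (yuG1Rat n)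

/-! ### `δ ≥ 1` and the `δ = 1` weakening -/

/-- For a non-zero rational `p`-adic unit, `p` divides neither numerator nor denominator.
[folklore] -/
theorem padicUnit_not_dvd_num_den {p : ℕ} (hp : p.Prime) {q : ℚ} (hq : q ≠ 0)
    (hv : padicValRat p q = 0) : ¬ p ∣ q.num.natAbs ∧ ¬ p ∣ q.den := by
  haveI := Fact.mk hp
  have hdef : padicValRat p q = ((padicValNat p q.num.natAbs : ℕ) : ℤ) - (padicValNat p q.den : ℤ) :=
    rfl
  have hnum0 : q.num.natAbs ≠ 0 := Int.natAbs_ne_zero.mpr (Rat.num_ne_zero.mpr hq)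
  by_cases hn : p ∣ q.num.natAbs
  · exfalso
    have hd : ¬ p ∣ q.den := by
      intro hd
      have hg : p ∣ Nat.gcd q.num.natAbs q.den := Nat.dvd_gcd hn hd
      rw [Nat.Coprime.gcd_eq_one q.reduced] at hg
      exact hp.one_lt.ne' (Nat.eq_one_of_dvd_one hg)
    have h1 : 1 ≤ padicValNat p q.num.natAbs := one_le_padicValNat_of_dvd hnum0 hn
    have h2 : padicValNat p q.den = 0 := padicValNat.eq_zero_of_not_dvd hd
    rw [hv, h2] at hdef
    omega
  · refine ⟨hn, fun hd => ?_⟩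
    have h1 : padicValNat p q.num.natAbs = 0 := padicValNat.eq_zero_of_not_dvd hn
    have h2 : 1 ≤ padicValNat p q.den := one_le_padicValNat_of_dvd q.den_pos.ne' hd
    rw [hv, h1] at hdef
    omega

/-- The reduction of a `p`-adic unit of `ℚ` is a unit of `ℤ/pℤ`. [folklore] -/
theorem isUnit_ratModP {p : ℕ} (hp : p.Prime) {q : ℚ} (hq : q ≠ 0) (hv : padicValRat p q = 0) :
    IsUnit (ratModP p q) := by
  haveI := Fact.mk hp
  obtain ⟨hn, hd⟩ := padicUnit_not_dvd_num_den hp hq hv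
  have hnum : IsUnit (q.num : ZMod p) := by
    have hcop : q.num.natAbs.Coprime p :=
      (Nat.coprime_comm).mp ((Nat.Prime.coprime_iff_not_dvd hp).mpr hn)
    have hu : IsUnit ((q.num.natAbs : ℕ) : ZMod p) := (ZMod.isUnit_iff_coprime _ _).mpr hcop
    rcases Int.natAbs_eq q.num with h | h
    · rw [h, Int.cast_natCast]; exact hu
    · rw [h, Int.cast_neg, Int.cast_natCast]; exact hu.neg
  have hden : IsUnit ((q.den : ZMod p)) := by
    have hcop : q.den.Coprime p :=
      (Nat.coprime_comm).mp ((Nat.Prime.coprime_iff_not_dvd hp).mpr hd)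
    exact (ZMod.isUnit_iff_coprime _ _).mpr hcop
  have hinv : IsUnit ((q.den : ZMod p))⁻¹ :=
    IsUnit.of_mul_eq_one_right _ (ZMod.mul_inv_of_unit _ hden)
  exact hnum.mul hinv

/-- `|⟨-1, ᾱ₁, …, ᾱₙ⟩| ≤ p - 1` when the `αᵢ` are `p`-adic units (the generated submonoid
consists of units of `ℤ/pℤ`). [folklore] -/
theorem stewartSubgroupCard_le {p : ℕ} (hp : p.Prime) {n : ℕ} {α : Fin n → ℚ}
    (hα : ∀ i, α i ≠ 0 ∧ padicValRat p (α i) = 0) : stewartSubgroupCard p α ≤ p - 1 := by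
  haveI := Fact.mk hp
  unfold stewartSubgroupCard
  set S := Submonoid.closure (insert (-1 : ZMod p) (Set.range fun i : Fin n => ratModP p (α i)))
  have hle : S ≤ IsUnit.submonoid (ZMod p) := by
    refine Submonoid.closure_le.mpr ?_
    rintro x (rfl | ⟨i, rfl⟩)
    · exact isUnit_one.neg
    · exact isUnit_ratModP hp (hα i).1 (hα i).2
  -- inject `S` into the units
  let f : S → (ZMod p)ˣ := fun x => (hle x.2).unit
  have hf : Function.Injective f := by
    intro x y hxy
    apply Subtype.ext
    have hx : ((f x : (ZMod p)ˣ) : ZMod p) = x := (hle x.2).unit_spec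
    have hy : ((f y : (ZMod p)ˣ) : ZMod p) = y := (hle y.2).unit_spec
    rw [← hx, ← hy, hxy]
  have h1 : Nat.card S ≤ Nat.card (ZMod p)ˣ := Nat.card_le_card_of_injective f hf
  have h3 : Nat.card (ZMod p)ˣ = p - 1 := by
    rw [Nat.card_eq_fintype_card, ZMod.card_units]
  omega

/-- `1 ≤ |⟨-1, ᾱ₁, …, ᾱₙ⟩|`. [folklore] -/
theorem one_le_stewartSubgroupCard (p : ℕ) [NeZero p] {n : ℕ} (α : Fin n → ℚ) :
    1 ≤ stewartSubgroupCard p α := by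
  unfold stewartSubgroupCard
  haveI : Finite (ZMod p) := inferInstance
  exact Nat.one_le_iff_ne_zero.mpr Nat.card_pos.ne'

/-- **`δ ≥ 1`** (over `ℚ`, for `p`-adic units `αᵢ`): in the Kummer case
`δ = (p-1)/|⟨-1, ᾱ⟩| ≥ 1` because the subgroup has order at most `p - 1`.
[cite: Stewart2013, §3 (definition of δ)] -/
theorem one_le_stewartDelta {p : ℕ} (hp : p.Prime) {n : ℕ} {α : Fin n → ℚ}
    (hα : ∀ i, α i ≠ 0 ∧ padicValRat p (α i) = 0) : 1 ≤ stewartDelta p α := by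
  haveI := Fact.mk hp
  unfold stewartDelta
  split_ifs with hK
  · have hN1 : (1 : ℝ) ≤ stewartSubgroupCard p α := by
      exact_mod_cast one_le_stewartSubgroupCard p α
    have hN2 : (stewartSubgroupCard p α : ℝ) ≤ (p : ℝ) - 1 := by
      have h := stewartSubgroupCard_le hp hα
      have hp1 : 1 ≤ p := hp.one_lt.le
      have : ((p - 1 : ℕ) : ℝ) = (p : ℝ) - 1 := by push_cast [Nat.cast_sub hp1]; ring
      rw [← this]
      exact_mod_cast h
    rw [le_div_iff₀ (by linarith)]
    linarith
  · exact le_rfl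

/-- `C` is non-increasing in `δ > 0`. [cite: Stewart2013, Lemma 5] -/
theorem stewartC_anti {n p : ℕ} (hp : 5 ≤ p) {δ δ' : ℝ} (hδ : 0 < δ) (hδδ' : δ ≤ δ') :
    stewartC n p δ' ≤ stewartC n p δ := by
  have hp' : (5 : ℝ) ≤ p := by exact_mod_cast hp
  have hfrac : 0 ≤ ((p : ℝ) - 1) / ((p : ℝ) - 2) := div_nonneg (by linarith) (by linarith)
  have hlog : 0 ≤ Real.log (Real.exp 4 * (n + 1)) := by
    apply Real.log_nonneg
    have h4 : (1 : ℝ) ≤ Real.exp 4 := Real.one_le_exp (by norm_num)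
    have hn : (1 : ℝ) ≤ (n : ℝ) + 1 := by
      have : (0 : ℝ) ≤ n := Nat.cast_nonneg n
      linarith
    nlinarith
  have hpre : 0 ≤ 376 * Real.sqrt (n + 1) * (7 * Real.exp 1 * (((p : ℝ) - 1) / ((p : ℝ) - 2))) ^ n *
      Real.log (Real.exp 4 * (n + 1)) := by positivity
  rw [stewartC_def, stewartC_def]
  apply mul_le_mul_of_nonneg_left _ hpre
  apply max_le_max _ le_rfl
  apply mul_le_mul_of_nonneg_right _ (by
    have hlogp : 0 ≤ Real.log p := Real.log_nonneg (by linarith)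
    positivity)
  exact div_le_div_of_nonneg_left (by positivity) hδ hδδ'

/-- **Lemma 5 over `ℚ` with `δ = 1`** — the weakening obtained from `δ ≥ 1` (`one_le_stewartDelta`)
and the monotonicity of `C` in `δ`; this is the shape used in Stewart's Lemma 8 ((29)) and by
route `ABC/LogCardinality`. [cite: Stewart2013, Lemma 5 and (29)] -/
theorem Stewart2013_lemma5_rat.delta_one (h : Stewart2013_lemma5_rat)
    (n p : ℕ) (α : Fin n → ℚ) (b : Fin n → ℤ) (hp : p.Prime) (hp5 : 5 ≤ p)
    (hα : ∀ i, α i ≠ 0 ∧ padicValRat p (α i) = 0)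
    (hind : ∀ e : Fin n → ℤ, ∏ i, α i ^ e i = 1 → e = 0) (hb : b ≠ 0) :
    (padicValRat p (∏ i, α i ^ b i - 1) : ℝ) <
      stewartC n p 1 * (∏ i, logHeight₁ (α i)) * max (Real.log (stewartB b)) (yuG1Rat n) := by
  have h1 := h n p α b hp hp5 hα hind hb
  have hC : stewartC n p (stewartDelta p α) ≤ stewartC n p 1 :=
    stewartC_anti hp5 one_pos (one_le_stewartDelta hp hα)
  have hH : 0 ≤ ∏ i, logHeight₁ (α i) := Finset.prod_nonneg fun i _ => zero_le_logHeight₁ _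
  have hM : 0 ≤ max (Real.log (stewartB b)) (yuG1Rat n) :=
    le_max_of_le_right (yuG1Rat_pos n).le
  refine lt_of_lt_of_le h1 ?_
  apply mul_le_mul_of_nonneg_right _ hM
  exact mul_le_mul_of_nonneg_right hC hH

end Literature.NumberTheory.DiophantineGeometry.Dioph
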